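import Literature.NumberTheory.GaloisRepresentations.LocalUnitsSecondInequality
import Literature.NumberTheory.GaloisRepresentations.LocalUnramifiedNormGroups
import Literature.Algebra.Homology.CyclicReferenceLayer
import Mathlib.FieldTheory.Galois.GaloisClosure
import HarnessLib

/-!
# The unramified cyclic reference frame `M = L₁ · K_m` of a finite Galois layer of a local field
# (Neukirch, *Bonn Lectures* II §5 Thm. (5.2), Lemma (5.3); Serre, *Local Fields* XIII §3)

Topic `NumberTheory/GaloisRepresentations` (local class field theory); namespaces
`Literature.NumberTheory.GaloisRepresentations.UnitsLayer` / `….LocalWeilDatum` (continuing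
`LocalCyclicLayerClassModule`, `LocalUnitsSecondInequality`, `LocalUnramifiedNormGroups`).  Proof file:
theorems only (no definition, no named fact, no instance, no notation; D-0026).  Consumed by
`LocalUnitsFundamentalClass.lean` (`|H²(Gal(L/K), Lˣ)| = [L:K]`, every layer a class module).

For `K` a non-archimedean local field and `L₁ ⊆ K̄` finite Galois over `K`, the inputs of the engine's
cyclic-reference-layer theorem `CyclicReference.natCard_H2_eq_card_quotient` (Neukirch III §6 (6.3) in
`Ĥ⁰`-form, door-c4's `Literature/Algebra/Homology/CyclicReferenceLayer`) for the ambient layer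
`M = L₁ · K_m`, `K_m = K(ζ_{q^m-1})` the unramified level (`LocalWeilDatum.unramifiedLevel`), `m = [L₁:K] · d`:

* §1 `nonempty_groupCohomology_units_iso_of_algEquiv` — transport of `Hⁿ(Gal(E/K), Eˣ)` along
  `E₁ ≃ₐ[K] E₂` (Serre XI §1 (iv)); `natCard_…_congr`, `isAddCyclic_…_congr`.
* §2 the unramified level over the BASE field: `LocalWeilDatum.fDeg_eq_one_of_eq_bot` (`f = 1` for `K₁ = ⊥`),
  `finrank_unramifiedLevel` (`[K_m : K] = m`), `isCyclic_gal_unramifiedLevel`, `isGalois_unramifiedLevel`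
  (from the tree's `K₁`-relative `finrank_unrLevel` / `isCyclic_gal_unrLevel` at an OPAQUE `K₁ = ⊥`, so that
  Mathlib's `IntermediateField.algebraOverBot` never competes with `towerAlgebra`).
* §3 quotient layers by the fixing subgroup of a Galois subextension `E ⊆ M`:
  `Hⁿ(Gal(M/K) ⧸ Gal(M/E), (Mˣ)^{Gal(M/E)}) ≅ Hⁿ(Gal(E/K), Eˣ)` (engine
  `InflationRestriction.quotientInvariantsUnitsCohomologyIso` + `fixedField_fixingSubgroup`),
  `|Gal(M/K) ⧸ Gal(M/E)| = [E:K]`, cyclicity transfer.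
* §4 the frame: `Gal(M/K_m) ⊓ Gal(M/L₁) = 1` (`fixingSubgroup_inf_fixingSubgroup_eq_bot`), `M/K` Galois, and
  the TRANSLATION INPUT **`nsmul_mem_range_norm_res_fixingSubgroup`: `a^d ∈ N_{M/L₁} Mˣ` for `a ∈ Kˣ`**
  when `[L₁:K] · d = m`, `f_{L₁} ∣ m` — `M/L₁` is the unramified extension `(L₁)_m` whose norm group is
  `{u : m ∣ t_{L₁}(u)}` (`LocalWeilDatum.range_unitsMap_norm_unrLevel`) and `t_{L₁}(a^d) = m · ord_K(a)`;
  `N_{M/L₁} b = ∏_{σ ∈ Gal(M/L₁)} σ b` (Mathlib `Algebra.norm_eq_prod_automorphisms`) is re-indexed over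
  `Gal(M/L₁) = (L₁ ↾ M).fixingSubgroup ≤ Gal(M/K)`.

## References
* J. Neukirch, *Class Field Theory — The Bonn Lectures* (2013), Part II §5 Thm. (5.2), Lemma (5.3);
  Part III §6 Thm. (6.3). [Neukirch2013]
* J.-P. Serre, *Local Fields*, GTM 67 (1979), Ch. XIII §3 (Prop. 6 and its proof), Ch. X §4 Prop. 6,
  Ch. XI §1 (iv), Ch. V §2 Cor. to Prop. 3. [SerreLocalFields1979]
* J. Neukirch, *Algebraic Number Theory* (1999), Ch. IV §4, Ch. V §1. [NeukirchANT1999]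
-/

noncomputable section

open CategoryTheory CategoryTheory.Limits groupCohomology

namespace Literature.NumberTheory.GaloisRepresentations

/-! ## §1. Transport of `Hⁿ(Gal(E/K), Eˣ)` along a `K`-isomorphism of fields -/

namespace UnitsLayer

open Literature.Algebra.Homology

section Transport

variable {K E₁ E₂ : Type} [Field K] [Field E₁] [Field E₂] [Algebra K E₁] [Algebra K E₂]

/-- **Transport of structure**: a `K`-isomorphism `e : E₁ ≃ₐ[K] E₂` induces `Gal(E₁/K) ≅ Gal(E₂/K)`
(`σ ↦ e σ e⁻¹`) and `E₁ˣ ≅ E₂ˣ` compatibly, hence `Hⁿ(Gal(E₁/K), E₁ˣ) ≅ Hⁿ(Gal(E₂/K), E₂ˣ)`.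
[cite: SerreLocalFields1979, Ch. XI §1 (iv)] -/
theorem nonempty_groupCohomology_units_iso_of_algEquiv (e : E₁ ≃ₐ[K] E₂) (n : ℕ) :
    Nonempty (groupCohomology (Rep.ofAlgebraAutOnUnits K E₁) n ≅
      groupCohomology (Rep.ofAlgebraAutOnUnits K E₂) n) := by
  refine ⟨groupCohomology.mapIso e.autCongr
    ((Units.mapEquiv (e : E₁ ≃* E₂)).toAdditive.toIntLinearEquiv) (fun g => ?_) n⟩
  apply LinearMap.ext
  intro x
  refine Additive.toMul.injective (Units.ext ?_)
  change e ((g • (Additive.toMul x : E₁ˣ) : E₁ˣ) : E₁) =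
    ((e.autCongr g • (Units.mapEquiv (e : E₁ ≃* E₂) (Additive.toMul x)) : E₂ˣ) : E₂)
  rw [AlgEquiv.smul_units_def, AlgEquiv.smul_units_def, Units.coe_map, Units.coe_map,
    MonoidHom.coe_coe, MonoidHom.coe_coe, Units.coe_mapEquiv, AlgEquiv.autCongr_apply,
    AlgEquiv.trans_apply, AlgEquiv.trans_apply]
  exact congrArg (fun y => e (g y)) (e.symm_apply_apply (Additive.toMul x : E₁ˣ)).symm

/-- `|Hⁿ(Gal(E₁/K), E₁ˣ)| = |Hⁿ(Gal(E₂/K), E₂ˣ)|` for `E₁ ≃ₐ[K] E₂`. [cite: SerreLocalFields1979, Ch. XI §1 (iv)] -/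
theorem natCard_groupCohomology_units_congr (e : E₁ ≃ₐ[K] E₂) (n : ℕ) :
    Nat.card (groupCohomology (Rep.ofAlgebraAutOnUnits K E₁) n) =
      Nat.card (groupCohomology (Rep.ofAlgebraAutOnUnits K E₂) n) := by
  obtain ⟨i⟩ := nonempty_groupCohomology_units_iso_of_algEquiv e n
  exact Nat.card_congr i.toLinearEquiv.toEquiv

/-- `Hⁿ(Gal(E₂/K), E₂ˣ)` is cyclic if `Hⁿ(Gal(E₁/K), E₁ˣ)` is, for `E₁ ≃ₐ[K] E₂`.
[cite: SerreLocalFields1979, Ch. XI §1 (iv)] -/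
theorem isAddCyclic_groupCohomology_units_congr (e : E₁ ≃ₐ[K] E₂) (n : ℕ)
    (h : IsAddCyclic (groupCohomology (Rep.ofAlgebraAutOnUnits K E₁) n)) :
    IsAddCyclic (groupCohomology (Rep.ofAlgebraAutOnUnits K E₂) n) := by
  obtain ⟨i⟩ := nonempty_groupCohomology_units_iso_of_algEquiv e n
  exact isAddCyclic_of_surjective i.toLinearEquiv i.toLinearEquiv.surjective

end Transport

end UnitsLayer

/-! ## §2. The unramified level `K_m ⊆ K̄` over the base field

The tree's `LocalWeilDatum.unrLevel F K₁ m = K₁ ⊔ F_m` is studied over an intermediate field `K₁ ⊆ F̄` (with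
the `K₁`-algebra structure `towerAlgebra`); over the base field itself we take `K₁ = ⊥` but keep it OPAQUE
inside the proofs (a variable `K₁` with `K₁ = ⊥`), so that Mathlib's special algebra structure
`IntermediateField.algebraOverBot` on the literal `⊥` never competes with `towerAlgebra`. -/

namespace LocalWeilDatum

open IsNonarchimedeanLocalField IntermediateField ValuativeRel
open scoped Valued

variable (F : Type) [Field F] [ValuativeRel F] [TopologicalSpace F] [IsNonarchimedeanLocalField F]

/-- **`f = 1` for the bottom subextension `F ⊆ F̄`** (any `K₁ = ⊥`): `f ∣ t(ϖ) = ord_F ϖ = 1` for a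
uniformiser `ϖ` of `F`. [cite: SerreLocalFields1979, Ch. II §2 Cor. 3] -/
theorem fDeg_eq_one_of_eq_bot (K₁ : IntermediateField F (AlgebraicClosure F)) (hK₁ : K₁ = ⊥) :
    haveI : FiniteDimensional F K₁ :=
      (IntermediateField.equivOfEq hK₁).symm.toLinearEquiv.finiteDimensional
    fDeg F K₁ = 1 := by
  haveI : FiniteDimensional F K₁ :=
    (IntermediateField.equivOfEq hK₁).symm.toLinearEquiv.finiteDimensional
  obtain ⟨ϖ, hϖ⟩ := IsDiscreteValuationRing.exists_irreducible 𝒪[F]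
  have hϖ0 : (ϖ : F) ≠ 0 := fun h => hϖ.ne_zero (Subtype.ext h)
  have ha0 : algebraMap F K₁ (ϖ : F) ≠ 0 := (map_ne_zero _).2 hϖ0
  have hdvd := fDeg_dvd_tVal F K₁ (hK₁ ▸ bot_le) ha0
  have hrank : Module.finrank F K₁ = 1 := by
    rw [← (IntermediateField.equivOfEq hK₁).symm.toLinearEquiv.finrank_eq, IntermediateField.finrank_bot]
  have htval : tVal F K₁ (algebraMap F K₁ (ϖ : F)) = 1 := by
    unfold tVal
    rw [Algebra.norm_algebraMap, hrank, pow_one]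
    exact ord_eq_one_of_irreducible F hϖ
  rw [htval] at hdvd
  have hpos := fDeg_pos F K₁
  have h1 : (fDeg F K₁ : ℤ) ≤ 1 := Int.le_of_dvd one_pos hdvd
  omega

/-- `F_m / F` is Galois. [cite: SerreLocalFields1979, Ch. IV §4 Cor. to Prop. 16] -/
theorem isGalois_unramifiedLevel {m : ℕ} (hm : 0 < m) : IsGalois F (unramifiedLevel F m) := by
  haveI := (unramifiedLevel_finite_abelian_unramified F hm).2.1
  infer_instance

/-- **`[F_m : F] = m`** (`[K_m : K₁] = m / f_{K₁}` at `K₁ = ⊥`, `f = 1`).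
[cite: SerreLocalFields1979, Ch. XIII §3][cite: NeukirchANT1999, Ch. IV §4] -/
theorem finrank_unramifiedLevel {m : ℕ} (hm : 0 < m) : Module.finrank F (unramifiedLevel F m) = m := by
  obtain ⟨K₁, hK₁⟩ : ∃ K₁ : IntermediateField F (AlgebraicClosure F), K₁ = ⊥ := ⟨⊥, rfl⟩
  haveI : FiniteDimensional F K₁ :=
    (IntermediateField.equivOfEq hK₁).symm.toLinearEquiv.finiteDimensional
  have hf : fDeg F K₁ = 1 := fDeg_eq_one_of_eq_bot F K₁ hK₁
  have h := finrank_unrLevel F K₁ (hK₁ ▸ bot_le) hm (by rw [hf]; exact one_dvd m)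
  rw [hf, Nat.div_one] at h
  letI := towerAlgebra (le_unrLevel F K₁ m)
  haveI := towerAlgebra_isScalarTower_bot (F := F) (le_unrLevel F K₁ m)
  have hrank : Module.finrank F K₁ = 1 := by
    rw [← (IntermediateField.equivOfEq hK₁).symm.toLinearEquiv.finrank_eq, IntermediateField.finrank_bot]
  have h2 := Module.finrank_mul_finrank F K₁ (unrLevel F K₁ m)
  rw [h, hrank, one_mul] at h2
  have hT : unrLevel F K₁ m = unramifiedLevel F m := by rw [unrLevel, hK₁, bot_sup_eq]
  rw [hT] at h2
  exact h2.symm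

/-- `F_m / F` is finite. [cite: SerreLocalFields1979, Ch. IV §4 Cor. to Prop. 16] -/
theorem finiteDimensional_unramifiedLevel {m : ℕ} (hm : 0 < m) :
    FiniteDimensional F (unramifiedLevel F m) :=
  (unramifiedLevel_finite_abelian_unramified F hm).1

/-- **`Gal(F_m / F)` is cyclic** (generated by the Frobenius; `Gal(K_m/K₁)` at `K₁ = ⊥`, every
`F`-automorphism being `K₁`-linear). [cite: SerreLocalFields1979, Ch. XIII §3][cite: NeukirchANT1999, Ch. IV §4] -/
theorem isCyclic_gal_unramifiedLevel {m : ℕ} (hm : 0 < m) :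
    IsCyclic (unramifiedLevel F m ≃ₐ[F] unramifiedLevel F m) := by
  obtain ⟨K₁, hK₁⟩ : ∃ K₁ : IntermediateField F (AlgebraicClosure F), K₁ = ⊥ := ⟨⊥, rfl⟩
  haveI : FiniteDimensional F K₁ :=
    (IntermediateField.equivOfEq hK₁).symm.toLinearEquiv.finiteDimensional
  have hT : unrLevel F K₁ m = unramifiedLevel F m := by rw [unrLevel, hK₁, bot_sup_eq]
  rw [← hT]
  letI := towerAlgebra (le_unrLevel F K₁ m)
  haveI := isCyclic_gal_unrLevel F K₁ (hK₁ ▸ bot_le) hm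
  -- every `F`-automorphism of `K_m` is `K₁`-linear (`K₁ = ⊥`)
  let f : (unrLevel F K₁ m ≃ₐ[K₁] unrLevel F K₁ m) →* (unrLevel F K₁ m ≃ₐ[F] unrLevel F K₁ m) :=
    { toFun := fun σ => σ.restrictScalars F
      map_one' := rfl
      map_mul' := fun _ _ => rfl }
  refine isCyclic_of_surjective f fun τ => ?_
  refine ⟨{ (τ : unrLevel F K₁ m ≃+* unrLevel F K₁ m) with commutes' := fun b => ?_ },
    AlgEquiv.ext fun x => rfl⟩
  obtain ⟨c, hc⟩ := IntermediateField.mem_bot.1 (hK₁.le b.2)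
  have hb : algebraMap K₁ (unrLevel F K₁ m) b = algebraMap F (unrLevel F K₁ m) c :=
    Subtype.ext (by rw [towerAlgebra_algebraMap_apply]; exact hc.symm)
  change τ (algebraMap _ _ b) = algebraMap _ _ b
  rw [hb, AlgEquiv.commutes]

end LocalWeilDatum

namespace UnitsLayer

open Literature.Algebra.Homology IntermediateField

/-! ## §3. Quotient layers of `(Gal(M/K), Mˣ)` by the fixing subgroup of a Galois subextension -/

section QuotientLayer

variable (K M : Type) [Field K] [Field M] [Algebra K M] [FiniteDimensional K M] [IsGalois K M]
variable (E : IntermediateField K M) [IsGalois K E]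

/-- **`Hⁿ(Gal(M/K) ⧸ Gal(M/E), (Mˣ)^{Gal(M/E)}) ≅ Hⁿ(Gal(E/K), Eˣ)`** for a Galois subextension
`K ⊆ E ⊆ M` (`Gal(M/E) = E.fixingSubgroup`): the engine's `(Mˣ)^S = (M^S)ˣ`
(`InflationRestriction.quotientInvariantsUnitsCohomologyIso`) at `S = Gal(M/E)`, `M^S = E`.
[cite: SerreLocalFields1979, Ch. X §4 Prop. 6][cite: SerreLocalFields1979, Ch. XI §1 (iv)] -/
theorem nonempty_quotientToInvariants_fixingSubgroup_iso (n : ℕ) :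
    Nonempty (groupCohomology ((Rep.ofAlgebraAutOnUnits K M).quotientToInvariants E.fixingSubgroup) n ≅
      groupCohomology (Rep.ofAlgebraAutOnUnits K E) n) := by
  obtain ⟨i⟩ := nonempty_groupCohomology_units_iso_of_algEquiv
    (IntermediateField.equivOfEq (IsGalois.fixedField_fixingSubgroup E)) n
  exact ⟨(InflationRestriction.quotientInvariantsUnitsCohomologyIso K M E.fixingSubgroup n).trans i⟩

/-- `|Gal(M/K) ⧸ Gal(M/E)| = [E : K]`. [cite: SerreLocalFields1979, Ch. X §4 Prop. 6] -/
theorem natCard_quotient_fixingSubgroup :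
    Nat.card ((M ≃ₐ[K] M) ⧸ E.fixingSubgroup) = Module.finrank K E := by
  rw [Nat.card_congr (IsGalois.normalAutEquivQuotient E.fixingSubgroup).toEquiv,
    Nat.card_congr (IntermediateField.equivOfEq (IsGalois.fixedField_fixingSubgroup E)).autCongr.toEquiv,
    IsGalois.card_aut_eq_finrank]

/-- `Gal(M/K) ⧸ Gal(M/E) ≅ Gal(E/K)` is cyclic when `Gal(E/K)` is. [cite: SerreLocalFields1979, Ch. X §4 Prop. 6] -/
theorem isCyclic_quotient_fixingSubgroup [IsCyclic (E ≃ₐ[K] E)] :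
    IsCyclic ((M ≃ₐ[K] M) ⧸ E.fixingSubgroup) :=
  let e : ((M ≃ₐ[K] M) ⧸ E.fixingSubgroup) ≃* (E ≃ₐ[K] E) :=
    (IsGalois.normalAutEquivQuotient E.fixingSubgroup).trans
      (IntermediateField.equivOfEq (IsGalois.fixedField_fixingSubgroup E)).autCongr
  isCyclic_of_surjective e.symm e.symm.surjective

end QuotientLayer

/-! ## §4. The frame `M = L₁ · K_m ⊇ L₁, K_m ⊇ K` (Neukirch II §5; Serre XIII §3) -/

section Frame

open LocalWeilDatum

variable (K : Type) [Field K] [ValuativeRel K] [TopologicalSpace K] [IsNonarchimedeanLocalField K]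
variable (L₁ : IntermediateField K (AlgebraicClosure K)) [FiniteDimensional K L₁] [IsGalois K L₁]

omit [ValuativeRel K] [TopologicalSpace K] [IsNonarchimedeanLocalField K] [FiniteDimensional K L₁] in
/-- A Galois subextension of `K̄` is separable: `L₁ ⊆ K^sep`. [cite: Neukirch2013, Part II §5 (setting)] -/
theorem le_sepClosure_of_isGalois : L₁ ≤ sepClosure K :=
  (le_separableClosure_iff K (AlgebraicClosure K) L₁).2 inferInstance

omit [FiniteDimensional K L₁] [IsGalois K L₁] in
/-- `K_m ≤ L₁ · K_m` (the compositum of Thm. (5.2)). [cite: Neukirch2013, Part II §5 Thm. (5.2)] -/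
theorem unramifiedLevel_le_unrLevel (m : ℕ) : unramifiedLevel K m ≤ unrLevel K L₁ m := by
  change unramifiedLevel K m ≤ L₁ ⊔ unramifiedLevel K m
  exact le_sup_right

omit [FiniteDimensional K L₁] in
/-- `M = L₁ · K_m` is Galois over `K` (compositum of Galois extensions).
[cite: Neukirch2013, Part II §5 Thm. (5.2) (proof)] -/
theorem isGalois_unrLevel_base {m : ℕ} (hm : 0 < m) : IsGalois K (unrLevel K L₁ m) := by
  haveI := isGalois_unramifiedLevel K hm
  change IsGalois K ↥(L₁ ⊔ unramifiedLevel K m)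
  infer_instance

omit [FiniteDimensional K L₁] [IsGalois K L₁] in
/-- In `Gal(M/K)`, `M = L₁ · K_m`: **`Gal(M/K_m) ⊓ Gal(M/L₁) = 1`** (an automorphism fixing `K_m` and `L₁`
fixes their compositum). [cite: Neukirch2013, Part II §5 Thm. (5.2) (proof)] -/
theorem fixingSubgroup_inf_fixingSubgroup_eq_bot (m : ℕ) :
    (IntermediateField.restrict (unramifiedLevel_le_unrLevel K L₁ m)).fixingSubgroup ⊓
      (IntermediateField.restrict (le_unrLevel K L₁ m)).fixingSubgroup = ⊥ := by
  have htop : IntermediateField.restrict (unramifiedLevel_le_unrLevel K L₁ m) ⊔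
      IntermediateField.restrict (le_unrLevel K L₁ m) = ⊤ := by
    refine IntermediateField.lift_injective _ ?_
    rw [IntermediateField.lift_sup, IntermediateField.lift_restrict, IntermediateField.lift_restrict,
      IntermediateField.lift_top]
    exact sup_comm _ _
  rw [← IntermediateField.fixingSubgroup_sup, htop, IntermediateField.fixingSubgroup_top]

/-- **The translation input: `a^d ∈ N_{M/L₁} Mˣ` for `a ∈ Kˣ`**, `M = L₁ · K_m`, `m = [L₁:K] · d`,
`f_{L₁} ∣ m` — in the engine's currency: for a `Gal(M/K)`-invariant `a ∈ Mˣ`, `d • a` is the norm of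
`Res_{Gal(M/L₁)} Mˣ`.  (`M/L₁` is the unramified extension of degree `m/f_{L₁}`, whose norm group is
`{u : m ∣ t_{L₁}(u)}` — `LocalWeilDatum.range_unitsMap_norm_unrLevel` — and
`t_{L₁}(a^d) = d · [L₁:K] · ord_K(a) = m · ord_K(a)`.)
[cite: Neukirch2013, Part II §5 Lemma (5.3)][cite: SerreLocalFields1979, Ch. V §2 Cor. to Prop. 3] -/
theorem nsmul_mem_range_norm_res_fixingSubgroup {m d : ℕ} (hm : 0 < m)
    (hmd : Module.finrank K L₁ * d = m) (hfm : fDeg K L₁ ∣ m)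
    [Fintype ↥(IntermediateField.restrict (le_unrLevel K L₁ m)).fixingSubgroup]
    (a : (Rep.ofAlgebraAutOnUnits K (unrLevel K L₁ m)).V)
    (ha : ∀ g : unrLevel K L₁ m ≃ₐ[K] unrLevel K L₁ m, (Rep.ofAlgebraAutOnUnits K (unrLevel K L₁ m)).ρ g a = a) :
    d • a ∈ LinearMap.range
      (Rep.res (IntermediateField.restrict (le_unrLevel K L₁ m)).fixingSubgroup.subtype
        (Rep.ofAlgebraAutOnUnits K (unrLevel K L₁ m))).ρ.norm := by
  classical
  haveI := finiteDimensional_unrLevel K L₁ hm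
  haveI := isGalois_unrLevel_base K L₁ hm
  -- the invariant unit `a` is `c ∈ Kˣ`
  set u : (unrLevel K L₁ m)ˣ := Additive.toMul a with hu_def
  have hfix : ∀ g : unrLevel K L₁ m ≃ₐ[K] unrLevel K L₁ m, g (u : unrLevel K L₁ m) = u := by
    intro g
    -- `A.ρ g a = ofMul (g • toMul a)` and `g • u = Units.map g u`, definitionally
    exact congrArg (fun v : Additive (unrLevel K L₁ m)ˣ =>
      ((Additive.toMul v : (unrLevel K L₁ m)ˣ) : unrLevel K L₁ m)) (ha g)
  obtain ⟨c, hc⟩ := (IsGalois.mem_range_algebraMap_iff_fixed (u : unrLevel K L₁ m)).2 hfix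
  have hc0 : c ≠ 0 := by
    rintro rfl
    exact u.ne_zero (by rw [← hc, map_zero])
  -- the layer `M/L₁` and its norm group
  letI := towerAlgebra (le_unrLevel K L₁ m)
  haveI := towerAlgebra_isScalarTower_bot (F := K) (le_unrLevel K L₁ m)
  haveI := towerAlgebra_finiteDimensional (F := K) (le_unrLevel K L₁ m)
  haveI : IsGalois L₁ (unrLevel K L₁ m) := IsGalois.tower_top_of_isGalois K L₁ (unrLevel K L₁ m)
  have hcL : algebraMap K L₁ c ≠ 0 := (map_ne_zero _).2 hc0
  set u₁ : L₁ˣ := Units.mk0 (algebraMap K L₁ c) hcL ^ d with hu₁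
  have hn0 : 0 < Module.finrank K L₁ := Module.finrank_pos
  have ht : (m : ℤ) ∣ tVal K L₁ (u₁ : L₁) := by
    rw [hu₁, Units.val_pow_eq_pow_val, Units.val_mk0, tVal_pow K L₁ hcL d]
    unfold tVal
    rw [Algebra.norm_algebraMap, ord_pow K hc0]
    refine ⟨ord K c, ?_⟩
    rw [← hmd]
    push_cast
    ring
  obtain ⟨b, hb⟩ := exists_norm_eq_of_dvd_tVal K L₁ (le_sepClosure_of_isGalois K L₁) hm hfm u₁ ht
  have hnb : Algebra.norm L₁ (b : unrLevel K L₁ m) = (u₁ : L₁) := by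
    have h := congrArg Units.val hb
    simpa only [Units.coe_map, MonoidHom.coe_coe] using h
  -- `algebraMap L₁ M (N b) = u ^ d`
  have hlhs : algebraMap L₁ (unrLevel K L₁ m) (u₁ : L₁) = (u : unrLevel K L₁ m) ^ d := by
    rw [hu₁, Units.val_pow_eq_pow_val, Units.val_mk0, map_pow, ← IsScalarTower.algebraMap_apply, hc]
  -- `N b = ∏_{σ ∈ Gal(M/L₁)} σ b = ∏_{h ∈ H} h b`
  have hprod := Algebra.norm_eq_prod_automorphisms L₁ (b : unrLevel K L₁ m)
  rw [hnb, hlhs] at hprod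
  let e : (unrLevel K L₁ m ≃ₐ[L₁] unrLevel K L₁ m) ≃
      ↥(IntermediateField.restrict (le_unrLevel K L₁ m)).fixingSubgroup :=
    { toFun := fun σ => ⟨σ.restrictScalars K, (IntermediateField.mem_fixingSubgroup_iff _ _).2
        fun x hx => by
          have hx' : (x : AlgebraicClosure K) ∈ L₁ := (IntermediateField.mem_restrict _ x).1 hx
          have hxe : x = algebraMap L₁ (unrLevel K L₁ m) ⟨x, hx'⟩ := Subtype.ext rfl
          rw [AlgEquiv.restrictScalars_apply, hxe]
          exact σ.commutes _⟩
      invFun := fun g =>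
        { ((g : unrLevel K L₁ m ≃ₐ[K] unrLevel K L₁ m) : unrLevel K L₁ m ≃+* unrLevel K L₁ m) with
          commutes' := fun r => (IntermediateField.mem_fixingSubgroup_iff _ _).1 g.2
            (algebraMap L₁ (unrLevel K L₁ m) r) ((IntermediateField.mem_restrict _ _).2 r.2) }
      left_inv := fun σ => AlgEquiv.ext fun _ => rfl
      right_inv := fun g => Subtype.ext (AlgEquiv.ext fun _ => rfl) }
  have hreindex : (∏ σ : unrLevel K L₁ m ≃ₐ[L₁] unrLevel K L₁ m, σ (b : unrLevel K L₁ m)) =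
      ∏ h : ↥(IntermediateField.restrict (le_unrLevel K L₁ m)).fixingSubgroup,
        (h : unrLevel K L₁ m ≃ₐ[K] unrLevel K L₁ m) (b : unrLevel K L₁ m) :=
    Fintype.prod_equiv e _ _ fun _ => rfl
  -- conclusion
  have key : (∑ x : ↥(IntermediateField.restrict (le_unrLevel K L₁ m)).fixingSubgroup,
      (Additive.ofMul (Units.map ((x : unrLevel K L₁ m ≃ₐ[K] unrLevel K L₁ m) :
        unrLevel K L₁ m →* unrLevel K L₁ m) b) : Additive (unrLevel K L₁ m)ˣ)) =
      d • Additive.ofMul u := by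
    rw [← ofMul_prod, ← ofMul_pow]
    refine congrArg Additive.ofMul (Units.ext ?_)
    rw [Units.coe_prod, Units.val_pow_eq_pow_val, hprod, hreindex]
    refine Finset.prod_congr rfl fun h _ => ?_
    rw [Units.coe_map, MonoidHom.coe_coe]
  refine ⟨Additive.ofMul b, ?_⟩
  rw [CyclicReference.res_norm_apply]
  -- `A.ρ x (ofMul b) = ofMul (x • b) = ofMul (Units.map x b)` and `a = ofMul u`, definitionally
  exact key

end Frame

end UnitsLayer

end Literature.NumberTheory.GaloisRepresentations

end
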